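import Literature.Computability.AlgebraicComplexity.LandsbergRessayreNormalForm
import HarnessLib

/-!
# Rank-one determinantal expressions of the permanent (Ikenmeyer–Landsberg 2017, Thm. 2.9)

Topic `Literature/Computability/AlgebraicComplexity`, next to `DeterminantalComplexity.lean`
(`IsAffineDetRepr`) and `LandsbergRessayreNormalForm.lean` (von zur Gathen's regularity fact).

Source: C. Ikenmeyer, J. M. Landsberg, *On the complexity of the permanent in various
computational models*, J. Pure Appl. Algebra **221** (2017) 2911–2927, arXiv:1610.00159
[IkenmeyerLandsberg2017]. Printed statements (arXiv v2, §1–2 and §6.2):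

* §1: "A size `n` determinantal expression for `P` is an expression `P = det_n(Λ + Σ_j X^j y^j)`
  where `X^j, Λ` are `n × n` complex matrices."  In the tree this is exactly an affine
  determinantal representation `IsAffineDetRepr P A` (`DeterminantalComplexity.lean`): `Λ` is the
  matrix of constant coefficients `A.map constantCoeff` and `X^e` is the matrix of coefficients of
  the variable `y^e`, `Matrix.of fun i j => coeff (Finsupp.single e 1) (A i j)` (the same expression
  as in route `ValiantsHypothesis/PrincipalMinorColouring`, item `NormalForm`).
* §2: "A determinantal expression is called *regular* if `rank Λ = n - 1`."
* Definition 2.8: "`P` admits a *rank `k`* determinantal expression if there is a determinantal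
  expression `P = det(Λ + Σ_j y^j X^j)` with `rank X^j ≤ k`."
* **Theorem 2.9.** "Neither `perm_m` nor `det_m` admits a rank one regular determinantal expression
  over `ℂ` when `m ≥ 3`. In particular, neither `perm_m` nor `det_m` admits a read once regular
  determinantal expression over `ℂ` when `m ≥ 3`."  (Proof: §6.2, Lemma 6.2 = monotonicity in `m`
  by setting the last row and column of variables to `0`, and Lemma 6.3 = the case `m = 3` by a
  case analysis on standard-form expressions.)
* §2 (quoting von zur Gathen 1987): "any determinantal expression of a polynomial whose singular
  locus has codimension at least five, e.g., the permanent, must be regular. In particular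
  `rdc(perm_m) = dc(perm_m)`."  In tree: the named fact `vonzurGathen1987_perm_detRepr_rank`
  (`LandsbergRessayreNormalForm.lean`; reduced to two height facts, one of them discharged, in
  `VonZurGathenRegularity*.lean`).

Contents:
* `ikenmeyerLandsberg2017_perm_no_rankOne_regular` (NAMED FACT) — Thm. 2.9, permanent half;
* `ikenmeyerLandsberg2017_det_no_rankOne_regular` (NAMED FACT) — Thm. 2.9, determinant half;
* `perm_no_rankOne_detRepr` (PROVED from the two facts it names) — the form used downstream and
  stated in IL17 §1 ("we prove `perm_m` does not admit a rank one determinantal expression for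
  `m ≥ 3`"): for `m ≥ 3`, `per_m` has NO affine determinantal representation over `ℂ`, of any size,
  all of whose coefficient matrices have rank `≤ 1` — regularity being automatic by von zur
  Gathen (`rank Λ ≥ n - 1` at the point `0`, and `rank Λ ≤ n - 1` since `det Λ = per_m(0) = 0`).

Purpose: grounds the `r = 1` rung of route `ValiantsHypothesis/PrincipalMinorColouring`
(`Summit.ValiantsHypothesis.ValiantsHypothesis.Theses.PrincipalMinorColouring.BoundedRankImpossible`
at `r = 1`, the base of its `Heredity` inductions, and the `k = 0` case of `ExcessRankUnbounded`),
as requested in that route's DEFINITION REQUESTS. The route speaks of principal-minor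
representations `per_n(x+J) = n!·det(I_R + diag(x∘κ)K)` with colour classes of size `≤ r`; such a
representation is an affine determinantal representation (substitute `x = y - J`, absorb `n!`)
whose coefficient matrix of `y^e` is `diag(𝟙_{κ = e})·K`, of rank `≤ |κ⁻¹(e)| ≤ r` — so the rung
`r = 1` is `perm_no_rankOne_detRepr ∘` (route item `PMReprIsDetRepr`-type bookkeeping). Ranks
`k ≥ 2` are OPEN (Aravind–Joglekar 2015, §5; IL17 give nothing beyond `k = 1`).

Conventions: `Matrix.rank` is Mathlib's (rank of `mulVecLin` over `ℂ`); "regular" is written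
`Λ.rank + 1 = n` to avoid `ℕ`-subtraction (for `n = 0` the hypothesis is unsatisfiable, and indeed
`det` of the empty matrix is `1 ≠ per_m`).
-/

noncomputable section

open Matrix MvPolynomial

namespace Literature.Computability.AlgebraicComplexity

/-! ### The named facts (Theorem 2.9) -/

/-- NAMED FACT (**Ikenmeyer–Landsberg 2017, Theorem 2.9, permanent half**; with Def. 2.8 and the
definition of *regular* in §2): for `m ≥ 3` there is no affine determinantal representation
`per_m = det A`, `A = Λ + Σ_e y^e X^e` an `n × n` matrix of affine linear forms over `ℂ`, which is
regular (`rank Λ = n - 1`, `Λ = A.map constantCoeff`) and rank one (`rank X^e ≤ 1` for every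
variable `y^e`, `X^e = (coeff_{y^e} A_{ij})_{ij}`). Printed: "Neither `perm_m` nor `det_m` admits a
rank one regular determinantal expression over `ℂ` when `m ≥ 3`." Users take
`(h : ikenmeyerLandsberg2017_perm_no_rankOne_regular)`; see `perm_no_rankOne_detRepr` for the
version without the regularity hypothesis. [cite: IkenmeyerLandsberg2017, Theorem 2.9] -/
def ikenmeyerLandsberg2017_perm_no_rankOne_regular : Prop :=
  ∀ (m : ℕ), 3 ≤ m → ∀ (n : ℕ) (A : Matrix (Fin n) (Fin n) (MvPolynomial (Fin m × Fin m) ℂ)),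
    IsAffineDetRepr (perPoly (Fin m) ℂ) A →
      (A.map MvPolynomial.constantCoeff).rank + 1 = n →
        (∀ e : Fin m × Fin m,
          (Matrix.of fun i j => MvPolynomial.coeff (Finsupp.single e 1) (A i j)).rank ≤ 1) →
          False

/-- NAMED FACT (**Ikenmeyer–Landsberg 2017, Theorem 2.9, determinant half**): for `m ≥ 3` the
generic determinant `det_m = detPoly (Fin m) ℂ` has no regular (`rank Λ = n - 1`) rank-one
(`rank X^e ≤ 1` for all `e`) affine determinantal representation over `ℂ`, of any size `n`.
(For `det_m` regularity is NOT automatic: `det_m = det (y^{ij})` itself is a rank-one, read-once,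
non-regular expression with `Λ = 0`; IL17 Prop. 2.3 bounds `rdc(det_m) ≤ (m³ - m)/3 + 1`.) Users take
`(h : ikenmeyerLandsberg2017_det_no_rankOne_regular)`. [cite: IkenmeyerLandsberg2017, Theorem 2.9] -/
def ikenmeyerLandsberg2017_det_no_rankOne_regular : Prop :=
  ∀ (m : ℕ), 3 ≤ m → ∀ (n : ℕ) (A : Matrix (Fin n) (Fin n) (MvPolynomial (Fin m × Fin m) ℂ)),
    IsAffineDetRepr (detPoly (Fin m) ℂ) A →
      (A.map MvPolynomial.constantCoeff).rank + 1 = n →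
        (∀ e : Fin m × Fin m,
          (Matrix.of fun i j => MvPolynomial.coeff (Finsupp.single e 1) (A i j)).rank ≤ 1) →
          False

/-! ### Regularity is automatic for the permanent (von zur Gathen), hence: no rank-one expression -/

/-- **`per_m`, `m ≥ 3`, admits no rank-one determinantal expression over `ℂ`** (Ikenmeyer–Landsberg
2017, §1: "We prove `perm_m` does not admit a rank one determinantal expression for `m ≥ 3`",
= Thm. 2.9 + von zur Gathen 1987, Thm. 3.1), PROVED from the two named facts: an affine
determinantal representation `A` of `per_m` with all coefficient matrices of rank `≤ 1` is
impossible. Regularity of `A` comes from `vonzurGathen1987_perm_detRepr_rank` at the point `v = 0`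
(`rank Λ + 1 ≥ n`, `Λ = A(0) = A.map constantCoeff` by `MvPolynomial.eval_zero`) and from
`det Λ = constantCoeff (per_m) = 0` (`rank Λ < n`). This is the `r = 1` rung of
`Summit.ValiantsHypothesis.ValiantsHypothesis.Theses.PrincipalMinorColouring.BoundedRankImpossible`.
[cite: IkenmeyerLandsberg2017, Theorem 2.9] -/
theorem perm_no_rankOne_detRepr (hIL : ikenmeyerLandsberg2017_perm_no_rankOne_regular)
    (hvzG : vonzurGathen1987_perm_detRepr_rank) {m : ℕ} (hm : 3 ≤ m) {n : ℕ}
    {A : Matrix (Fin n) (Fin n) (MvPolynomial (Fin m × Fin m) ℂ)}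
    (hA : IsAffineDetRepr (perPoly (Fin m) ℂ) A)
    (h1 : ∀ e : Fin m × Fin m,
      (Matrix.of fun i j => MvPolynomial.coeff (Finsupp.single e 1) (A i j)).rank ≤ 1) :
    False := by
  refine hIL m hm n A hA ?_ h1
  -- lower bound `n ≤ rank Λ + 1` from von zur Gathen at `v = 0`
  have hge : n ≤ (A.map (MvPolynomial.eval (0 : Fin m × Fin m → ℂ))).rank + 1 :=
    hvzG ℂ two_ne_zero m hm n A hA.2 0
  rw [MvPolynomial.eval_zero] at hge
  -- upper bound `rank Λ < n` from `det Λ = per_m(0) = 0`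
  have hdet : (A.map (MvPolynomial.constantCoeff (σ := Fin m × Fin m) (R := ℂ))).det = 0 := by
    have h := RingHom.map_det (MvPolynomial.constantCoeff (σ := Fin m × Fin m) (R := ℂ)) A
    rw [RingHom.mapMatrix_apply, hA.2, constantCoeff_perPoly ℂ (show 1 ≤ m by omega)] at h
    exact h.symm
  have hlt := Matrix.rank_lt_card_of_det_eq_zero hdet
  rw [Fintype.card_fin] at hlt
  omega

end Literature.Computability.AlgebraicComplexity
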